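import Mathlib
import Literature.MathematicalPhysics.QuantumFieldTheory.Balaban1983to89.T4EtaRateDefect
import Literature.MathematicalPhysics.QuantumFieldTheory.Balaban1983to89.B11AxialTransport190
import HarnessLib

/-!
# Route «BalabanUVNodes» (K4 «SpineRates»), node N15 = NE2, BACKGROUND LAYER — THE OPERATOR-LAYER READOUT: block majorants of the four
# (3.42)-entry operators ⇒ the node's FIRST CONJUNCT `T4EtaRate.EtaRateIneq342` ∕ `NE2PlusOperator` BY NAME, on the [B9] geometry whose
# argument sort is REALISED by lattice functions with cube support and the sup norm — for ANY background carrier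

Cell `pub-ymgap`, seat `pub-ymgap-dag-n15-b` (FIRST-MISSING-ESTIMATE, D-0062; `bears_on: R4∕N15`; `--supports stmt-QuantumFields-19351 --as helper`).
Imports `T4EtaRateDefect` (cell `pub-balaban`, lineage pv25; through it `T4EtaRate`, `B11SectG`) BY NAME; nothing landed is modified.

THE SEAM THIS CLOSES.  `T4EtaRateDefectSite` (HONEST LIMIT (a), and cell `pub-balaban` GAPS G-t4-U1a-5, verbatim): *«`T4EtaRate.EtaRateIneq342` (the
OPERATOR layer of NE2⁺, shape of [B9] (3.42) p.397) quantifies over the ABSTRACT argument type `g.Loc` of `B9.Geometry` … no REALISATION MAP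
`g.Loc → (X → ℝ)` … exists in the tree, so the operator layer cannot be read out of block majorants the way the site layer now is; … either (a) a
concrete `B9.Geometry` instance fixes `Loc := {f : X → ℝ // …}` with the obvious norms (then `EtaRateIneq342` follows …)»*.  `T4EtaRateOperatorTorus`
took option (a) AT `U ≡ 1` ON THE UNIT TORUS (`torusOpGeo`, one-point backgrounds `pt9Bg`).  THIS FILE takes option (a) GENERICALLY: for ANY block
geometry `g : B6.Geometry` (the currency of `B11SectG` ∕ `T4EtaRateDefect` ∕ this seat's `…N15.DerivDefect`, `…N15.BackgroundStep`), ANY coarse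
lattice `X` blocked by `blk : X → 𝔅`, ANY fine lattice `X′` blocked by `blk′`, and ANY background carrier `B : B9.Backgrounds`, the [B9] geometry
`opGeo g X blk` realises the argument sort by `X → ℝ` with `suppIn λ y′` = «λ vanishes off the cube `y′`» and `supNorm λ = sup_x |λ x|`, the four
entry operators `T n U : (X → ℝ) →ₗ (X′ → ℝ)` (in applications the η-DIFFERENCE operators `𝔇(G′, G)`, `𝔇(∇′G′, ∇G)`, `𝔇(G′∇′*, G∇*)`, `𝔇(Δ′G′, ΔG)`
of the two runs, `T4EtaRateDefect.idef`) are read as the kernel family `opFamily` whose entry `e n U λ y` is the sup of `|T n U λ|` over the fine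
cube `y`, and THEN: a block majorant of `T n U` of the printed (3.42) SHAPE with the row's max-rate-factor IS `EtaRateIneq342` (`etaRateIneq342_of_hasMaj`),
the SOURCE-WEIGHTED majorants `c_n·e^{−δ₀d}·w_γ(y′)` that the defect calculus produces (`T4EtaRateDefect.rateWeight`) give it whenever
`c_n ≤ B₀·pref4(L^jη)_n` (`etaRateIneq342_of_hasMaj_rateWeight`), and the uniform quantifier block gives `NE2PlusOperator` BY NAME for a family of
such realised instances over ANY backgrounds (`ne2PlusOperator_of_hasMaj`) — the background block is NOT inert here: `B`, `Reg335` are the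
consumer's (cf. ref-B READ #5 on the -a knit: at `pt9Bg` the «+» block is inert).

THE PRINT (SHAPE only; quoted from the cross-read tree header `B9.lean`).  [Balaban1985BackgroundPropagators] Thm 3.1 (3.42) p. 397: the entries
*«|(G′λ)(x)|, |(∇_U G′λ)(x)|, |(G′∇*_U λ)(x)|, |(Δ_U G′λ)(x)|»* for `x ∈ Δ(y)`, `supp λ ⊂ Δ(y′)`, bounded by `B₀[(L^jη)², L^jη, L^jη, 1]e^{−δ₀d(y,y′)}|λ|`
(`B9.pref4`); p. 397: *«if y ∈ Λ_j, then Δ(y) = B^j(y)»* — the cube support and the sup over the cube are exactly `BlockNorm.ofBlocks`'s `IsLoc` and `loc`.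

CONTENTS ([folklore] plumbing + bookkeeping; 4 defs).
* §1 `opGeo g X blk : B9.Geometry` (argument sort realised; Hölder ∕ L² ∕ cut-off sorts INERT — (3.43)–(3.47) are not given an η-rate shape by the
  row either), `opGeo_len`, `rateFactor_opGeo` (`= T4EtaRateDefect.rateWeight g γ` for `η ≠ 0`, `L > 0`), `suppIn_opGeo_iff`, `loc_le_supNorm_opGeo`.
* §2 `opFamily blk′ T : B9.KernelFamily (opGeo g X blk) B`, `opFamily_e`.
* §3 PRODUCERS: `etaRateIneq342_of_hasMaj` (one configuration, exact (3.42) shape), `etaRateIneq342_of_hasMaj_rateWeight` (from the defect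
  calculus' source-weighted currency); §3b `prefWeight` + `etaRateIneq342_of_hasMaj_prefWeighted` (the (3.42) prefactors as a TARGET weight
  `T4EtaRateDefect.wnorm` — the currency in which the background step runs with site-independent constants); §4 `ne2PlusOperator_of_hasMaj` (the node's first conjunct BY NAME for a family of realised instances with
  uniform constants, ANY backgrounds and pairings).

HONEST FRAMING ∕ LIMITS.  Typing + bookkeeping: nothing about Bałaban's operators is asserted, no majorant is proved here (they are binders — produced,
for the background step, by this seat's `…N15.BackgroundStep.idef_background_propagator_majorant` from the NE2⁰ layer and letters); the realised
geometry keeps [B9]'s sites ∕ scales ∕ distance and collapses nothing, but models `sup_{x ∈ Δ(y)}` by the sharp cube sup and leaves the Hölder ∕ L²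
∕ global sorts inert.  NE2⁺ NOT PRINTED, NOT proved; count-neutral (typed 28∕28 · discharged 0∕28); one finite T⁴ at fixed ε — NOT infinite volume,
NOT OS on ℝ⁴, NOT a mass gap, NOT Clay.
-/

noncomputable section

namespace Summit.QuantumFields.YangMills.BalabanUVNodes.N15.OperatorReadout

open Literature.MathematicalPhysics.QuantumFieldTheory.Balaban1983to89
open Literature.MathematicalPhysics.QuantumFieldTheory.Balaban1983to89.B11SectG (BlockNorm HasMaj)
open Literature.MathematicalPhysics.QuantumFieldTheory.Balaban1983to89.T4EtaRate (PairedInstance EtaPairing EtaRateIneq342 NE2PlusOperator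
  rateFactor)
open Literature.MathematicalPhysics.QuantumFieldTheory.Balaban1983to89.T4EtaRateDefect (rateWeight wnorm)
open Literature.MathematicalPhysics.QuantumFieldTheory.Balaban1983to89.B11AxialTransport190 (abs_le_loc_ofBlocks loc_ofBlocks_le)

/-! ## §1 The [B9] geometry with the argument sort realised by lattice functions -/

/-- THE REALISED OPERATOR GEOMETRY over a block geometry `g` (sites 𝔅, scales, distance, `k`, `η`, `L`, `M` kept) and a lattice `X` blocked by
`blk : X → 𝔅`: arguments `λ : X → ℝ`; `suppIn λ y′` = «`λ` vanishes off the cube `y′`» (= `BlockNorm.ofBlocks`' `IsLoc`); `supNorm λ = sup_x |λ x|`;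
the enlarged-cube support is taken equal to the cube support; the weighted ∕ Hölder ∕ L² sizes and the cut-off sort are INERT (`0` ∕ `Unit`).
[cite: Balaban1985BackgroundPropagators, (3.42) p.397 («supp λ ⊂ Δ(y′)», «x ∈ Δ(y)»: typing template)] -/
@[reducible] def opGeo (g : B6.Geometry) (X : Type) [Fintype X] (blk : X → g.Site) : B9.Geometry where
  Site := g.Site
  scale := g.scale
  dist := g.dist
  k := g.k
  eta := g.eta
  L := g.L
  M := g.M
  Loc := X → ℝ
  suppIn := fun lam y' => ∀ x, blk x ≠ y' → lam x = 0
  suppInT := fun lam y' => ∀ x, blk x ≠ y' → lam x = 0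
  supNorm := fun lam => ⨆ x : X, |lam x|
  l2Norm := fun _ => 0
  wNorm := fun _ _ => 0
  holder := fun _ _ => 0
  Cut := Unit
  cutIn := fun _ _ => True
  cutInT := fun _ _ => True
  cutH := fun _ _ => 0
  cutSup := fun _ => 0
  suppInT_of_suppIn := fun _ _ h => h
  cutInT_of_cutIn := fun _ _ h => h

section Geo

variable (g : B6.Geometry) (X : Type) [Fintype X] (blk : X → g.Site)

/-- The scale length of the realised geometry is the block geometry's `L^jη`. [folklore] -/
theorem opGeo_len (y : g.Site) : (opGeo g X blk).len y = g.len y := rfl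

/-- The realised geometry's support predicate IS `BlockNorm.ofBlocks`' localisation. [folklore] -/
theorem suppIn_opGeo_iff (lam : X → ℝ) (y' : g.Site) :
    (opGeo g X blk).suppIn lam y' ↔ (BlockNorm.ofBlocks g blk).IsLoc y' lam := Iff.rfl

/-- The rate factor of the realised geometry is the defect calculus' η-rate weight `(L^j)^{−γ}` (`η ≠ 0`, `L > 0`). [folklore] -/
theorem rateFactor_opGeo (hη : g.eta ≠ 0) (hL : 0 < g.L) (γ : ℝ) (y : g.Site) :
    rateFactor (opGeo g X blk) γ y = rateWeight g γ y := by
  rw [T4EtaRate.rateFactor_eq_rpow_scale (g := opGeo g X blk) hη hL]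
  rfl

/-- The cube sup is below the sup norm: `loc_{y′}(λ) ≤ sup_x |λ x|`. [folklore] -/
theorem loc_le_supNorm_opGeo (lam : X → ℝ) (y' : g.Site) :
    (BlockNorm.ofBlocks g blk).loc y' lam ≤ (opGeo g X blk).supNorm lam := by
  refine loc_ofBlocks_le blk lam (Real.iSup_nonneg fun x => abs_nonneg (lam x)) fun x _ => ?_
  exact le_ciSup (Finite.bddAbove_range fun x => |lam x|) x

/-- The sup norm is non-negative. [folklore] -/
theorem supNorm_opGeo_nonneg (lam : X → ℝ) : 0 ≤ (opGeo g X blk).supNorm lam :=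
  Real.iSup_nonneg fun x => abs_nonneg (lam x)

end Geo

/-! ## §2 The four entry operators as a kernel family -/

section Family

variable {g : B6.Geometry} {X X' : Type} [Fintype X] [Fintype X'] (blk : X → g.Site) (blk' : X' → g.Site)
  {B : B9.Backgrounds}

/-- THE ENTRY FAMILY of four coarse-to-fine operators `T n U` (the η-difference operators of the two runs' propagator entries): entry
`e n U λ y` = the sup of `|T n U λ|` over the FINE cube `y` (`BlockNorm.ofBlocks g blk′`); the Hölder ∕ L² ∕ global quantities INERT (`0`).
[cite: Balaban1985BackgroundPropagators, (3.42) p.397 (the four sup entries: shape)] -/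
def opFamily (T : Fin 4 → B.Cfg → ((X → ℝ) →ₗ[ℝ] (X' → ℝ))) : B9.KernelFamily (opGeo g X blk) B where
  e := fun n U lam y => (BlockNorm.ofBlocks g blk').loc y (T n U lam)
  h1 := fun _ _ _ _ => 0
  e4 := fun _ _ _ => 0
  h2 := fun _ _ _ _ => 0
  l2 := fun _ _ _ _ => 0
  glob := fun _ _ _ _ => 0

/-- Unfolding of the entries. [folklore] -/
@[simp] theorem opFamily_e (T : Fin 4 → B.Cfg → ((X → ℝ) →ₗ[ℝ] (X' → ℝ))) (n : Fin 4) (U : B.Cfg) (lam : X → ℝ) (y : g.Site) :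
    (opFamily blk blk' T).e n U lam y = (BlockNorm.ofBlocks g blk').loc y (T n U lam) := rfl

end Family

/-! ## §3 Producers: block majorants ⇒ the operator layer BY NAME -/

section Producers

variable {g : B6.Geometry} {X X' : Type} [Fintype X] [Fintype X'] (blk : X → g.Site) (blk' : X' → g.Site)
  {B : B9.Backgrounds}

/-- **PRODUCER, one configuration, exact (3.42) shape.**  If each entry operator `T n U` has the block majorant
`B₀·pref4(L^jη)_n·e^{−δ₀d(y,y′)}·max(rf(y), rf(y′))` between the sharp cube norms (coarse `blk` → fine `blk′`), with `B₀ ≥ 0` and `η, L ≥ 0`,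
then the entry family satisfies `T4EtaRate.EtaRateIneq342` on the realised geometry. [cite: Balaban1985BackgroundPropagators, Thm 3.1 (3.42) p.397 (shape)] -/
theorem etaRateIneq342_of_hasMaj (hη : 0 ≤ g.eta) (hL : 0 ≤ g.L) {B₀ δ₀ γ : ℝ} (hB₀ : 0 ≤ B₀)
    (T : Fin 4 → B.Cfg → ((X → ℝ) →ₗ[ℝ] (X' → ℝ))) (U : B.Cfg)
    (h : ∀ n : Fin 4, HasMaj (BlockNorm.ofBlocks g blk) (BlockNorm.ofBlocks g blk') (T n U)
      (fun y y' => B₀ * B9.pref4 ((opGeo g X blk).len y) n * Real.exp (-(δ₀ * g.dist y y')) *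
        max (rateFactor (opGeo g X blk) γ y) (rateFactor (opGeo g X blk) γ y'))) :
    EtaRateIneq342 (opFamily blk blk' T) B₀ δ₀ γ U := by
  intro n lam y y' hs
  rw [opFamily_e]
  have hloc : (BlockNorm.ofBlocks g blk).IsLoc y' lam := (suppIn_opGeo_iff g X blk lam y').mp hs
  have key := h n y' lam hloc y
  have hpref : 0 ≤ B9.pref4 ((opGeo g X blk).len y) n := by
    have h0 : 0 ≤ (opGeo g X blk).len y := by
      rw [opGeo_len]
      exact mul_nonneg (pow_nonneg hL _) hη
    fin_cases n <;> simp [B9.pref4] <;> positivity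
  have hK : 0 ≤ B₀ * B9.pref4 ((opGeo g X blk).len y) n * Real.exp (-(δ₀ * g.dist y y')) *
      max (rateFactor (opGeo g X blk) γ y) (rateFactor (opGeo g X blk) γ y') :=
    mul_nonneg (mul_nonneg (mul_nonneg hB₀ hpref) (Real.exp_nonneg _))
      ((T4EtaRate.rateFactor_nonneg (g := opGeo g X blk) hη hL γ y).trans (le_max_left _ _))
  exact key.trans (mul_le_mul_of_nonneg_left (loc_le_supNorm_opGeo g X blk lam y') hK)

/-- **PRODUCER from the defect calculus' currency.**  If each entry operator `T n U` has a SOURCE-WEIGHTED block majorant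
`c_n·e^{−δ₀d(y,y′)}·w_γ(y′)` with the η-rate weight `w_γ = T4EtaRateDefect.rateWeight g γ` (what `idef_neumann_majorant_rateWeight` ∕ this seat's
`idef_background_propagator_majorant` produce) and the entry constants fit the printed prefactors, `0 ≤ c_n ≤ B₀·pref4(L^jη)_n` at every site, then
`EtaRateIneq342` holds with `(B₀, δ₀, γ)` (`η ≠ 0`, `L > 0`; the source factor is one of the two in the `max`). [folklore] -/
theorem etaRateIneq342_of_hasMaj_rateWeight (hη : 0 < g.eta) (hL : 0 < g.L) {B₀ δ₀ γ : ℝ} (hB₀ : 0 ≤ B₀) {c : Fin 4 → ℝ}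
    (hc : ∀ n, 0 ≤ c n) (hcB : ∀ (n : Fin 4) (y : g.Site), c n ≤ B₀ * B9.pref4 (g.len y) n)
    (T : Fin 4 → B.Cfg → ((X → ℝ) →ₗ[ℝ] (X' → ℝ))) (U : B.Cfg)
    (h : ∀ n : Fin 4, HasMaj (BlockNorm.ofBlocks g blk) (BlockNorm.ofBlocks g blk') (T n U)
      (fun y y' => c n * Real.exp (-(δ₀ * g.dist y y')) * rateWeight g γ y')) :
    EtaRateIneq342 (opFamily blk blk' T) B₀ δ₀ γ U := by
  refine etaRateIneq342_of_hasMaj blk blk' hη.le hL.le hB₀ T U fun n => (h n).mono fun y y' => ?_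
  rw [← rateFactor_opGeo g X blk hη.ne' hL γ y', opGeo_len]
  have hE : 0 ≤ Real.exp (-(δ₀ * g.dist y y')) := Real.exp_nonneg _
  have hrf : 0 ≤ rateFactor (opGeo g X blk) γ y' := T4EtaRate.rateFactor_nonneg (g := opGeo g X blk) hη.le hL.le γ y'
  calc c n * Real.exp (-(δ₀ * g.dist y y')) * rateFactor (opGeo g X blk) γ y'
      ≤ (B₀ * B9.pref4 (g.len y) n) * Real.exp (-(δ₀ * g.dist y y')) * rateFactor (opGeo g X blk) γ y' :=
        mul_le_mul_of_nonneg_right (mul_le_mul_of_nonneg_right (hcB n y) hE) hrf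
    _ ≤ (B₀ * B9.pref4 (g.len y) n) * Real.exp (-(δ₀ * g.dist y y')) *
          max (rateFactor (opGeo g X blk) γ y) (rateFactor (opGeo g X blk) γ y') :=
        mul_le_mul_of_nonneg_left (le_max_right _ _) (mul_nonneg ((hc n).trans (hcB n y)) hE)

end Producers


/-! ## §3b The observation-weighted currency: the (3.42) prefactors as a weight on the fine cube norm -/

section PrefWeighted

variable {g : B6.Geometry} {X X' : Type} [Fintype X] [Fintype X'] (blk : X → g.Site) (blk' : X' → g.Site)
  {B : B9.Backgrounds}

/-- The (3.42) prefactors are positive at sites of positive scale length. [folklore] -/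
theorem pref4_pos {t : ℝ} (ht : 0 < t) (n : Fin 4) : 0 < B9.pref4 t n := by
  fin_cases n <;> simp [B9.pref4] <;> positivity

/-- THE OBSERVATION WEIGHT of entry `n`: `W_n(y) = pref4(L^jη)_n⁻¹ = [(L^jη)^{−2}, (L^jη)^{−1}, (L^jη)^{−1}, 1]_n` — reweighting the fine cube norm by `W_n`
(`T4EtaRateDefect.wnorm`) puts the (3.42) normalisation of entry `n` into the TARGET norm, so that a majorant with a site-INDEPENDENT constant expresses
the printed scale dependence (the currency in which `T4EtaRateDefect` ∕ `…N15.BackgroundStep` run). [cite: Balaban1985BackgroundPropagators, Thm 3.1 (3.42) p.397 (prefactors: shape)] -/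
noncomputable def prefWeight (g : B6.Geometry) (n : Fin 4) (y : g.Site) : ℝ := (B9.pref4 (g.len y) n)⁻¹

/-- The observation weight is non-negative (`η, L ≥ 0`). [folklore] -/
theorem prefWeight_nonneg (hη : 0 ≤ g.eta) (hL : 0 ≤ g.L) (n : Fin 4) (y : g.Site) : 0 ≤ prefWeight g n y := by
  unfold prefWeight
  have h0 : 0 ≤ g.len y := mul_nonneg (pow_nonneg hL _) hη
  refine inv_nonneg.mpr ?_
  fin_cases n <;> simp [B9.pref4] <;> positivity

/-- **PRODUCER from the observation-weighted currency.**  If entry `n`'s operator has, from the sharp coarse cube norm to the fine cube norm REWEIGHTED by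
`W_n = pref4(L^jη)_n⁻¹`, the source-weighted majorant `c_n·e^{−δ₀d}·w_γ(y′)` (`0 ≤ c_n ≤ B₀`; `η, L > 0`), then the entry family satisfies `EtaRateIneq342`
with `(B₀, δ₀, γ)` — the scale dependence `[(L^jη)², L^jη, L^jη, 1]` of (3.42) is restored from the weight. [cite: Balaban1985BackgroundPropagators, Thm 3.1 (3.42) p.397 (shape)] -/
theorem etaRateIneq342_of_hasMaj_prefWeighted (hη : 0 < g.eta) (hL : 0 < g.L) {B₀ δ₀ γ : ℝ} {c : Fin 4 → ℝ}
    (hc : ∀ n, 0 ≤ c n) (hcB : ∀ n, c n ≤ B₀) (T : Fin 4 → B.Cfg → ((X → ℝ) →ₗ[ℝ] (X' → ℝ))) (U : B.Cfg)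
    (h : ∀ n : Fin 4, HasMaj (BlockNorm.ofBlocks g blk)
      (wnorm (BlockNorm.ofBlocks g blk') (prefWeight g n) (prefWeight_nonneg hη.le hL.le n)) (T n U)
      (fun y y' => c n * Real.exp (-(δ₀ * g.dist y y')) * rateWeight g γ y')) :
    EtaRateIneq342 (opFamily blk blk' T) B₀ δ₀ γ U := by
  have hB₀ : 0 ≤ B₀ := (hc 0).trans (hcB 0)
  refine etaRateIneq342_of_hasMaj blk blk' hη.le hL.le hB₀ T U fun n => ?_
  intro y' μ hμ y
  have key := h n y' μ hμ y
  -- key : W_n(y) · loc_y(T n U μ) ≤ c_n e^{−δ₀d} w_γ(y′) · loc_{y′} μ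
  change prefWeight g n y * (BlockNorm.ofBlocks g blk').loc y (T n U μ) ≤ _ at key
  have hlen : 0 < g.len y := mul_pos (pow_pos hL _) hη
  have hP : 0 < B9.pref4 (g.len y) n := pref4_pos hlen n
  have hW : prefWeight g n y = (B9.pref4 (g.len y) n)⁻¹ := rfl
  rw [hW, inv_mul_le_iff₀ hP] at key
  refine key.trans ?_
  beta_reduce
  rw [← rateFactor_opGeo g X blk hη.ne' hL γ y', opGeo_len]
  have hE : 0 ≤ Real.exp (-(δ₀ * g.dist y y')) := Real.exp_nonneg _
  have hrf : 0 ≤ rateFactor (opGeo g X blk) γ y' := T4EtaRate.rateFactor_nonneg (g := opGeo g X blk) hη.le hL.le γ y'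
  have hloc : 0 ≤ (BlockNorm.ofBlocks g blk).loc y' μ := (BlockNorm.ofBlocks g blk).loc_nonneg y' μ
  have hmax : rateFactor (opGeo g X blk) γ y' ≤ max (rateFactor (opGeo g X blk) γ y) (rateFactor (opGeo g X blk) γ y') :=
    le_max_right _ _
  calc B9.pref4 (g.len y) n * (c n * Real.exp (-(δ₀ * g.dist y y')) * rateFactor (opGeo g X blk) γ y' *
          (BlockNorm.ofBlocks g blk).loc y' μ)
      = (c n * B9.pref4 (g.len y) n * Real.exp (-(δ₀ * g.dist y y')) * rateFactor (opGeo g X blk) γ y') *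
          (BlockNorm.ofBlocks g blk).loc y' μ := by ring
    _ ≤ (B₀ * B9.pref4 (g.len y) n * Real.exp (-(δ₀ * g.dist y y')) *
          max (rateFactor (opGeo g X blk) γ y) (rateFactor (opGeo g X blk) γ y')) * (BlockNorm.ofBlocks g blk).loc y' μ := by
        refine mul_le_mul_of_nonneg_right ?_ hloc
        exact mul_le_mul (mul_le_mul_of_nonneg_right (mul_le_mul_of_nonneg_right (hcB n) hP.le) hE) hmax hrf
          (mul_nonneg (mul_nonneg hB₀ hP.le) hE)

end PrefWeighted

/-! ## §4 The node's first conjunct BY NAME for a family of realised instances over ANY backgrounds -/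

section Node

variable {I : Type} (g : I → B6.Geometry) (X : I → Type) [∀ i, Fintype (X i)] (X' : I → Type) [∀ i, Fintype (X' i)]
  (blk : ∀ i, X i → (g i).Site) (blk' : ∀ i, X' i → (g i).Site) (gf : I → B9.Geometry) (Bc Bf : I → B9.Backgrounds)
  (pair : ∀ i, EtaPairing (opGeo (g i) (X i) (blk i)) (gf i) (Bc i) (Bf i))
  (T : ∀ i, Fin 4 → (Bf i).Cfg → ((X i → ℝ) →ₗ[ℝ] (X' i → ℝ)))

/-- The family of REALISED PAIRED INSTANCES: coarse geometry = the realised operator geometry `opGeo (g i) (X i) (blk i)`; the fine geometry, the two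
background carriers and the η-pairing (NOT PRINTED data, `T4EtaRate.EtaPairing`) are the consumer's. [folklore] -/
def realisedInstance (i : I) : PairedInstance := ⟨opGeo (g i) (X i) (blk i), gf i, Bc i, Bf i, pair i⟩

/-- **THE NODE'S FIRST CONJUNCT BY NAME.**  For a family of realised instances over ANY background carriers: if there are UNIFORM constants
`M₅, δ₀, a₀, B₀, γ > 0` such that for `M ≥ M₅`, `0 < α₀`, `Mα₀ ≤ a₀` and every (3.35)-regular fine configuration `U` each entry operator has the
(3.42)-shaped block majorant with the max-rate-factor (`η, L ≥ 0`), then `T4EtaRate.NE2PlusOperator c35 pi K` holds for the realised paired instances and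
their entry families — the background block is the consumer's (`Reg335` of the chosen carrier), not inert. [cite: Balaban1985BackgroundPropagators, Thm 3.1 p.397 (quantifier template)] -/
theorem ne2PlusOperator_of_hasMaj (c35 : ℝ) (hη : ∀ i, 0 ≤ (g i).eta) (hL : ∀ i, 0 ≤ (g i).L)
    (h : ∃ M₅ δ₀ a₀ B₀ γ : ℝ, 0 < M₅ ∧ 0 < δ₀ ∧ 0 < a₀ ∧ 0 < B₀ ∧ 0 < γ ∧
      ∀ i : I, M₅ ≤ (gf i).M → ∀ α₀ : ℝ, 0 < α₀ → (gf i).M * α₀ ≤ a₀ →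
        ∀ U : (Bf i).Cfg, (Bf i).Reg335 c35 α₀ U → ∀ n : Fin 4,
          HasMaj (BlockNorm.ofBlocks (g i) (blk i)) (BlockNorm.ofBlocks (g i) (blk' i)) (T i n U)
            (fun y y' => B₀ * B9.pref4 ((opGeo (g i) (X i) (blk i)).len y) n * Real.exp (-(δ₀ * (g i).dist y y')) *
              max (rateFactor (opGeo (g i) (X i) (blk i)) γ y) (rateFactor (opGeo (g i) (X i) (blk i)) γ y'))) :
    NE2PlusOperator c35 (realisedInstance g X blk gf Bc Bf pair) (fun i => opFamily (blk i) (blk' i) (T i)) := by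
  obtain ⟨M₅, δ₀, a₀, B₀, γ, hM₅, hδ₀, ha₀, hB₀, hγ, hall⟩ := h
  refine ⟨M₅, δ₀, a₀, B₀, γ, hM₅, hδ₀, ha₀, hB₀, hγ, fun i hM α₀ hα₀ ha U hU => ?_⟩
  exact etaRateIneq342_of_hasMaj (blk i) (blk' i) (hη i) (hL i) hB₀.le (T i) U (hall i hM α₀ hα₀ ha U hU)

/-- **THE NODE'S FIRST CONJUNCT BY NAME, observation-weighted currency.**  The same for hypotheses in the currency the background step runs in: for
`M ≥ M₅`, `0 < α₀`, `Mα₀ ≤ a₀` and every (3.35)-regular fine `U`, entry `n`'s operator has, into the fine cube norm reweighted by `prefWeight n`, the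
source-weighted majorant `c_n·e^{−δ₀d}·w_γ(y′)` with UNIFORM `0 ≤ c_n ≤ B₀` (`η, L > 0` on every instance) ⇒ `NE2PlusOperator c35 pi K`. [folklore] -/
theorem ne2PlusOperator_of_hasMaj_prefWeighted (c35 : ℝ) (hη : ∀ i, 0 < (g i).eta) (hL : ∀ i, 0 < (g i).L)
    (h : ∃ M₅ δ₀ a₀ B₀ γ : ℝ, ∃ c : Fin 4 → ℝ, 0 < M₅ ∧ 0 < δ₀ ∧ 0 < a₀ ∧ 0 < B₀ ∧ 0 < γ ∧ (∀ n, 0 ≤ c n) ∧ (∀ n, c n ≤ B₀) ∧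
      ∀ i : I, M₅ ≤ (gf i).M → ∀ α₀ : ℝ, 0 < α₀ → (gf i).M * α₀ ≤ a₀ →
        ∀ U : (Bf i).Cfg, (Bf i).Reg335 c35 α₀ U → ∀ n : Fin 4,
          HasMaj (BlockNorm.ofBlocks (g i) (blk i))
            (wnorm (BlockNorm.ofBlocks (g i) (blk' i)) (prefWeight (g i) n) (prefWeight_nonneg (hη i).le (hL i).le n))
            (T i n U) (fun y y' => c n * Real.exp (-(δ₀ * (g i).dist y y')) * rateWeight (g i) γ y')) :
    NE2PlusOperator c35 (realisedInstance g X blk gf Bc Bf pair) (fun i => opFamily (blk i) (blk' i) (T i)) := by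
  obtain ⟨M₅, δ₀, a₀, B₀, γ, c, hM₅, hδ₀, ha₀, hB₀, hγ, hc, hcB, hall⟩ := h
  refine ⟨M₅, δ₀, a₀, B₀, γ, hM₅, hδ₀, ha₀, hB₀, hγ, fun i hM α₀ hα₀ ha U hU => ?_⟩
  exact etaRateIneq342_of_hasMaj_prefWeighted (blk i) (blk' i) (hη i) (hL i) hc hcB (T i) U (hall i hM α₀ hα₀ ha U hU)

end Node

end Summit.QuantumFields.YangMills.BalabanUVNodes.N15.OperatorReadout
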